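import Mathlib.Analysis.SpecialFunctions.SmoothTransition
import Mathlib.Analysis.SpecialFunctions.Trigonometric.Arctan
import Mathlib.Analysis.SpecialFunctions.Trigonometric.ArctanDeriv
import Mathlib.Analysis.SpecialFunctions.Sqrt
import Mathlib.Analysis.SpecialFunctions.Pow.Real
import Mathlib.Analysis.Real.Pi.Bounds
import Literature.Topology.FourManifolds.TorusCoordinates
import HarnessLib

/-!
# The planar structure of the handle: an explicitly invertible bent strip

Auxiliary real-variable construction for the model datum of Iwase's Proposition 3.5
[cite: Iwase1988, Prop. 3.5, p. 296] (`Iwase1988_gluckTwist_isTorusLinkSurgery`, reduced to a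
model problem on `S² × ℝ²` in `TorusSurgeryIwaseReduction`).  The unknotted torus of the model
consists of a graph part over the sphere and a *handle* joining the two polar columns; the handle
is organised around a planar "bent strip", constructed here.

We want a smooth injective map of the strip `[0, 1] × (-1, ∞) ∋ (s, a)` into the plane which
* near the two ends `s ≈ 0`, `s ≈ 1` is *literally* the vertical column
  `(s, a) ↦ (∓(1 + a), tan (π s))` (resp. `tan (π (1 - s))`): the slices `s = const` are
  horizontal and `a` is an affine transverse coordinate (`bentStrip_eq_of_le`,
  `bentStrip_eq_of_ge`) — this is what makes the handle agree *exactly* with the rotationally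
  equivariant polar model on the overlap;
* has a closed-form two-sided inverse (`bentStripInv`, `bentStrip_bentStripInv`,
  `bentStripInv_bentStrip`), smooth on the image of the strip (`contDiffAt_bentStripInv_bentStrip`).

No analytic coordinate system can be exactly a column on an interval and then bend (identity
theorem), so the map is assembled from three explicitly invertible smooth maps,
`bentStrip = hScale ∘ vScale ∘ polarMap`:
* `polarMap (s, a) = (-(1 + a) cos (π s), (1 + a) sin (π s))` (polar coordinates: the core
  `a = 0` is the upper unit semicircle, slices are rays);
* `vScale (X, Y) = (X, m(X) Y)` with `m = 1` near `X = 0` and `m = 1/|X|` near the ends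
  (`mfac`): there the rays `Y = |X| tan (π s)` become the horizontal lines `Y' = tan (π s)`;
* `hScale (X, Y') = (n(Y') X, Y')` with `n = √(1 + Y'²) = 1 / cos (π s)` for small `Y'`
  (`nfac`): there `X'' = ∓(1 + a)`, so the core becomes vertical and `a` affine.
The cut-offs are `Real.smoothTransition`-based (`lam`, `lam₂`).  We also record the mirror
symmetry `s ↦ 1 - s` (`bentStrip_one_sub`) and height bounds (`bentStrip_snd_nonneg`,
`bentStrip_snd_ge`: in the middle the strip stays at height `≥ 1/10`).

All statements here are elementary calculus [folklore]; the design is ours (it replaces the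
"obvious" tubular-neighbourhood argument of the source by explicit formulas).

## References
* Z. Iwase, *Dehn-surgery along a torus T²-knot*, Pacific J. Math. 133 (1988), 289–299,
  Prop. 3.5. [cite: Iwase1988]
-/

open scoped ContDiff
open Set Function Real

noncomputable section

namespace Literature.Topology.FourManifolds

namespace HandlePlanar

/-! ### The polar map of the strip -/

/-- **The polar map** `Π(s, a) = (-(1 + a) cos (π s), (1 + a) sin (π s))`: the strip
`[0, 1] × (-1, 1)` onto the upper half annulus, the core `a = 0` onto the upper unit semicircle
(from `(-1, 0)` at `s = 0` to `(1, 0)` at `s = 1`), the fibres `s = const` onto rays. [folklore] -/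
def polarMap (q : ℝ × ℝ) : ℝ × ℝ := (-(1 + q.2) * cos (π * q.1), (1 + q.2) * sin (π * q.1))

/-- The polar map is smooth. [folklore] -/
theorem contDiff_polarMap : ContDiff ℝ ∞ polarMap := by
  unfold polarMap
  fun_prop

/-- On the strip `0 ≤ s ≤ 1`, `-1 < a`, the polar map is injective. [folklore] -/
theorem polarMap_injOn : InjOn polarMap (Icc (0 : ℝ) 1 ×ˢ Ioi (-1 : ℝ)) := by
  rintro ⟨s, a⟩ ⟨⟨hs0, hs1⟩, ha⟩ ⟨s', a'⟩ ⟨⟨hs0', hs1'⟩, ha'⟩ h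
  simp only [polarMap, Prod.mk.injEq, mem_Ioi] at h ha ha'
  obtain ⟨h1, h2⟩ := h
  -- radii agree
  have hr : (1 + a) ^ 2 = (1 + a') ^ 2 := by
    have e1 : (-(1 + a) * cos (π * s)) ^ 2 + ((1 + a) * sin (π * s)) ^ 2 = (1 + a) ^ 2 := by
      nlinarith [sin_sq_add_cos_sq (π * s)]
    have e2 : (-(1 + a') * cos (π * s')) ^ 2 + ((1 + a') * sin (π * s')) ^ 2 = (1 + a') ^ 2 := by
      nlinarith [sin_sq_add_cos_sq (π * s')]
    rw [← e1, ← e2, h1, h2]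
  have ha2 : a = a' := by nlinarith
  subst ha2
  have hpos : 0 < 1 + a := by linarith
  have hc : cos (π * s) = cos (π * s') := by
    have := mul_left_cancel₀ (neg_ne_zero.2 hpos.ne') h1
    exact this
  have hs : π * s = π * s' :=
    injOn_cos ⟨by positivity, by nlinarith [pi_pos]⟩ ⟨by positivity, by nlinarith [pi_pos]⟩ hc
  exact Prod.ext (mul_left_cancel₀ pi_pos.ne' hs) rfl

/-! ### The vertical scaling `S_v`: rays become horizontal near the ends -/

/-- The end weight `λ(X) = smoothTransition ((X² - 1/5)/(4/25))`: `0` for `|X| ≤ √(1/5)`, `1` for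
`|X| ≥ 3/5` (near the two columns `X ≈ ∓1`). [folklore] -/
def lam (X : ℝ) : ℝ := smoothTransition ((X ^ 2 - 1 / 5) / (4 / 25))

/-- `λ` is smooth. [folklore] -/
theorem contDiff_lam : ContDiff ℝ ∞ lam :=
  smoothTransition.contDiff.comp (((contDiff_id.pow 2).sub contDiff_const).div_const _)

/-- `λ = 0` for `X² ≤ 1/5`. [folklore] -/
theorem lam_eq_zero {X : ℝ} (h : X ^ 2 ≤ 1 / 5) : lam X = 0 :=
  smoothTransition.zero_of_nonpos (div_nonpos_of_nonpos_of_nonneg (by linarith) (by norm_num))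

/-- `λ = 1` for `X² ≥ 9/25`. [folklore] -/
theorem lam_eq_one {X : ℝ} (h : 9 / 25 ≤ X ^ 2) : lam X = 1 :=
  smoothTransition.one_of_one_le ((one_le_div (by norm_num)).2 (by linarith))

/-- `0 ≤ λ ≤ 1`. [folklore] -/
theorem lam_mem (X : ℝ) : 0 ≤ lam X ∧ lam X ≤ 1 := ⟨smoothTransition.nonneg _, smoothTransition.le_one _⟩

/-- The vertical scaling factor `m(X) = (1 - λ) + λ/|X|` (written with `(X²)^{-1/2}`; equal to `1`
near `X = 0`). [folklore] -/
def mfac (X : ℝ) : ℝ := (1 - lam X) + lam X * (Real.sqrt (X ^ 2))⁻¹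

/-- `m = 1` for `X² ≤ 1/5`. [folklore] -/
theorem mfac_eq_one {X : ℝ} (h : X ^ 2 ≤ 1 / 5) : mfac X = 1 := by simp [mfac, lam_eq_zero h]

/-- `m = 1/|X|` for `X² ≥ 9/25`. [folklore] -/
theorem mfac_eq_inv {X : ℝ} (h : 9 / 25 ≤ X ^ 2) : mfac X = |X|⁻¹ := by
  simp [mfac, lam_eq_one h, Real.sqrt_sq_eq_abs]

/-- `m > 0`. [folklore] -/
theorem mfac_pos (X : ℝ) : 0 < mfac X := by
  obtain ⟨h0, h1⟩ := lam_mem X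
  unfold mfac
  have hs : 0 ≤ (Real.sqrt (X ^ 2))⁻¹ := inv_nonneg.2 (Real.sqrt_nonneg _)
  rcases h1.lt_or_eq with hlt | heq
  · nlinarith
  · have h9 : 1 / 5 < X ^ 2 := by
      by_contra hcon; push Not at hcon; rw [lam_eq_zero hcon] at heq; norm_num at heq
    rw [heq]
    simp only [sub_self, one_mul, zero_add]
    exact inv_pos.2 (Real.sqrt_pos.2 (by linarith))

/-- `m` is smooth (it is `1` on a neighbourhood of `X = 0`). [folklore] -/
theorem contDiff_mfac : ContDiff ℝ ∞ mfac := by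
  rw [contDiff_iff_contDiffAt]
  intro X
  by_cases hX : X ^ 2 < 1 / 5
  · have hev : ∀ᶠ Y in nhds X, mfac Y = 1 := by
      filter_upwards [(isOpen_lt (continuous_id.pow 2) continuous_const).mem_nhds hX] with Y hY
      exact mfac_eq_one hY.le
    exact contDiffAt_const.congr_of_eventuallyEq hev
  · have hX0 : X ≠ 0 := fun h => by rw [h] at hX; norm_num at hX
    have hX2 : X ^ 2 ≠ 0 := pow_ne_zero 2 hX0
    unfold mfac
    exact (contDiffAt_const.sub contDiff_lam.contDiffAt).add (contDiff_lam.contDiffAt.mul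
      (((contDiffAt_id.pow 2).sqrt hX2).inv (Real.sqrt_ne_zero'.2 (by positivity))))

/-- **The vertical scaling** `S_v (X, Y) = (X, m(X) · Y)`. Near the ends (`X² ≥ 9/25`) it maps
the ray through the origin of slope `tan θ` onto the horizontal line `Y' = |X| tan θ / |X| · …`:
`Y' = Y/|X|`, so the polar fibres (rays) become horizontal. [folklore] -/
def vScale (q : ℝ × ℝ) : ℝ × ℝ := (q.1, mfac q.1 * q.2)

/-- The inverse vertical scaling. [folklore] -/
def vScaleInv (q : ℝ × ℝ) : ℝ × ℝ := (q.1, (mfac q.1)⁻¹ * q.2)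

/-- `S_v⁻¹ ∘ S_v = id`. [folklore] -/
@[simp] theorem vScaleInv_vScale (q : ℝ × ℝ) : vScaleInv (vScale q) = q := by
  simp [vScale, vScaleInv, ← mul_assoc, inv_mul_cancel₀ (mfac_pos q.1).ne']

/-- `S_v ∘ S_v⁻¹ = id`. [folklore] -/
@[simp] theorem vScale_vScaleInv (q : ℝ × ℝ) : vScale (vScaleInv q) = q := by
  simp [vScale, vScaleInv, ← mul_assoc, mul_inv_cancel₀ (mfac_pos q.1).ne']

/-- `S_v` is injective. [folklore] -/
theorem vScale_injective : Injective vScale := HasLeftInverse.injective ⟨_, vScaleInv_vScale⟩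

/-- `S_v` is smooth. [folklore] -/
theorem contDiff_vScale : ContDiff ℝ ∞ vScale :=
  contDiff_fst.prodMk ((contDiff_mfac.comp contDiff_fst).mul contDiff_snd)

/-- `S_v⁻¹` is smooth. [folklore] -/
theorem contDiff_vScaleInv : ContDiff ℝ ∞ vScaleInv :=
  contDiff_fst.prodMk (((contDiff_mfac.comp contDiff_fst).inv fun q => (mfac_pos q.1).ne').mul
    contDiff_snd)

/-! ### The horizontal scaling `S_h`: the columns become vertical -/

/-- The column weight `λ₂(Y) = 1 - smoothTransition ((Y² - 9/25)/(7/25))`: `1` for `|Y| ≤ 3/5`,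
`0` for `|Y| ≥ 4/5`. [folklore] -/
def lam₂ (Y : ℝ) : ℝ := 1 - smoothTransition ((Y ^ 2 - 9 / 25) / (7 / 25))

/-- `λ₂` is smooth. [folklore] -/
theorem contDiff_lam₂ : ContDiff ℝ ∞ lam₂ :=
  contDiff_const.sub (smoothTransition.contDiff.comp (((contDiff_id.pow 2).sub contDiff_const).div_const _))

/-- `λ₂ = 1` for `Y² ≤ 9/25`. [folklore] -/
theorem lam₂_eq_one {Y : ℝ} (h : Y ^ 2 ≤ 9 / 25) : lam₂ Y = 1 := by
  rw [lam₂, smoothTransition.zero_of_nonpos (div_nonpos_of_nonpos_of_nonneg (by linarith) (by norm_num))]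
  ring

/-- `0 ≤ λ₂ ≤ 1`. [folklore] -/
theorem lam₂_mem (Y : ℝ) : 0 ≤ lam₂ Y ∧ lam₂ Y ≤ 1 := by
  constructor
  · have := smoothTransition.le_one ((Y ^ 2 - 9 / 25) / (7 / 25)); unfold lam₂; linarith
  · have := smoothTransition.nonneg ((Y ^ 2 - 9 / 25) / (7 / 25)); unfold lam₂; linarith

/-- The horizontal scaling factor `n(Y) = (1 - λ₂) + λ₂ √(1 + Y²)` (`= √(1 + Y²) = 1/cos θ` on the
columns, where `Y = tan θ`). [folklore] -/
def nfac (Y : ℝ) : ℝ := (1 - lam₂ Y) + lam₂ Y * Real.sqrt (1 + Y ^ 2)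

/-- `n = √(1 + Y²)` for `Y² ≤ 9/25`. [folklore] -/
theorem nfac_eq_sqrt {Y : ℝ} (h : Y ^ 2 ≤ 9 / 25) : nfac Y = Real.sqrt (1 + Y ^ 2) := by
  simp [nfac, lam₂_eq_one h]

/-- `n ≥ 1 > 0`. [folklore] -/
theorem one_le_nfac (Y : ℝ) : 1 ≤ nfac Y := by
  obtain ⟨h0, h1⟩ := lam₂_mem Y
  have hs : 1 ≤ Real.sqrt (1 + Y ^ 2) := by
    rw [Real.le_sqrt (by norm_num) (by positivity)]; nlinarith
  unfold nfac; nlinarith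

/-- `n > 0`. [folklore] -/
theorem nfac_pos (Y : ℝ) : 0 < nfac Y := lt_of_lt_of_le one_pos (one_le_nfac Y)

/-- `n` is smooth. [folklore] -/
theorem contDiff_nfac : ContDiff ℝ ∞ nfac :=
  (contDiff_const.sub contDiff_lam₂).add (contDiff_lam₂.mul ((contDiff_const.add
    (contDiff_id.pow 2)).sqrt fun Y => by positivity))

/-- **The horizontal scaling** `S_h (X, Y) = (n(Y) · X, Y)`. [folklore] -/
def hScale (q : ℝ × ℝ) : ℝ × ℝ := (nfac q.2 * q.1, q.2)

/-- The inverse horizontal scaling. [folklore] -/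
def hScaleInv (q : ℝ × ℝ) : ℝ × ℝ := ((nfac q.2)⁻¹ * q.1, q.2)

/-- `S_h⁻¹ ∘ S_h = id`. [folklore] -/
@[simp] theorem hScaleInv_hScale (q : ℝ × ℝ) : hScaleInv (hScale q) = q := by
  simp [hScale, hScaleInv, ← mul_assoc, inv_mul_cancel₀ (nfac_pos q.2).ne']

/-- `S_h ∘ S_h⁻¹ = id`. [folklore] -/
@[simp] theorem hScale_hScaleInv (q : ℝ × ℝ) : hScale (hScaleInv q) = q := by
  simp [hScale, hScaleInv, ← mul_assoc, mul_inv_cancel₀ (nfac_pos q.2).ne']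

/-- `S_h` is injective. [folklore] -/
theorem hScale_injective : Injective hScale := HasLeftInverse.injective ⟨_, hScaleInv_hScale⟩

/-- `S_h` is smooth. [folklore] -/
theorem contDiff_hScale : ContDiff ℝ ∞ hScale :=
  ((contDiff_nfac.comp contDiff_snd).mul contDiff_fst).prodMk contDiff_snd

/-- `S_h⁻¹` is smooth. [folklore] -/
theorem contDiff_hScaleInv : ContDiff ℝ ∞ hScaleInv :=
  ((((contDiff_nfac.comp contDiff_snd).inv fun q => (nfac_pos q.2).ne').mul contDiff_fst)).prodMk
    contDiff_snd

/-! ### The bent strip -/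

/-- **The bent strip** `Ψ⁻¹ = S_h ∘ S_v ∘ Π`: the planar structure of the handle — a smooth
injective local diffeomorphism of the strip `[0, 1] × (-1, 1)` onto a bent neighbourhood of an
arch, which near the two ends is LITERALLY a vertical column with horizontal fibres,
`(s, a) ↦ (∓(1 + a), tan (π s))` (`bentStrip_eq_of_le`), and in the middle plain polar
coordinates; every factor has a closed-form inverse. [folklore] -/
def bentStrip (q : ℝ × ℝ) : ℝ × ℝ := hScale (vScale (polarMap q))

/-- The bent strip is smooth. [folklore] -/
theorem contDiff_bentStrip : ContDiff ℝ ∞ bentStrip :=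
  contDiff_hScale.comp (contDiff_vScale.comp contDiff_polarMap)

/-- The bent strip is injective on the strip `0 ≤ s ≤ 1`, `-1 < a`. [folklore] -/
theorem bentStrip_injOn : InjOn bentStrip (Icc (0 : ℝ) 1 ×ˢ Ioi (-1 : ℝ)) := fun _ hq _ hq' h =>
  polarMap_injOn hq hq' (vScale_injective (hScale_injective h))

/-- **Normal form near the north end**: for `0 ≤ s ≤ 1/10` and `|a| ≤ 3/10`,
`Ψ⁻¹ (s, a) = (-(1 + a), tan (π s))` — a vertical column with horizontal fibres and affine
transverse coordinate. [folklore] -/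
theorem bentStrip_eq_of_le {s a : ℝ} (hs0 : 0 ≤ s) (hs : s ≤ 1 / 10) (ha : |a| ≤ 3 / 10) :
    bentStrip (s, a) = (-(1 + a), tan (π * s)) := by
  obtain ⟨ha1, ha2⟩ := abs_le.1 ha
  have hπ : π < 3.15 := pi_lt_d2
  have hπ3 : 3 < π := pi_gt_three
  have hθ : π * s ≤ 0.315 := by nlinarith [pi_pos]
  have hθ0 : 0 ≤ π * s := by positivity
  have hθπ : π * s ≤ π := by nlinarith [pi_pos]
  -- `cos (π s) ≥ cos 0.315 > 0.95`
  have hcos : 0.95 ≤ cos (π * s) := by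
    have h1 : cos (0.315 : ℝ) ≤ cos (π * s) :=
      cos_le_cos_of_nonneg_of_le_pi hθ0 (by linarith) hθ
    have h2 : (0.95 : ℝ) ≤ cos 0.315 := by
      have := Real.one_sub_sq_div_two_le_cos (x := 0.315)
      nlinarith
    linarith
  have hcpos : 0 < cos (π * s) := by linarith
  have hc0 : cos (π * s) ≠ 0 := hcpos.ne'
  have ha0 : 0 < 1 + a := by linarith
  have ha0' : 1 + a ≠ 0 := ha0.ne'
  have hprod : 0.665 ≤ (1 + a) * cos (π * s) := by nlinarith
  have hX2 : 9 / 25 ≤ (-(1 + a) * cos (π * s)) ^ 2 := by nlinarith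
  have habsX : |-(1 + a) * cos (π * s)| = (1 + a) * cos (π * s) := by
    rw [abs_of_neg (by nlinarith)]; ring
  -- vertical scaling: `Y' = Y/|X| = tan (π s)`
  have hY' : mfac (-(1 + a) * cos (π * s)) * ((1 + a) * sin (π * s)) = tan (π * s) := by
    rw [mfac_eq_inv hX2, habsX, tan_eq_sin_div_cos]
    field_simp
  have hsin0 : 0 ≤ sin (π * s) := sin_nonneg_of_nonneg_of_le_pi hθ0 hθπ
  have hsin : sin (π * s) ≤ 0.315 := (sin_le hθ0).trans hθ
  have htan0 : 0 ≤ tan (π * s) := by rw [tan_eq_sin_div_cos]; positivity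
  have htan1 : tan (π * s) ≤ 0.34 := by
    rw [tan_eq_sin_div_cos, div_le_iff₀ hcpos]; nlinarith
  have htan : tan (π * s) ^ 2 ≤ 9 / 25 := by nlinarith
  -- horizontal scaling: `n (tan (π s)) = 1 / cos (π s)`
  have hn : nfac (tan (π * s)) * cos (π * s) = 1 := by
    rw [nfac_eq_sqrt htan, ← Real.inv_sqrt_one_add_tan_sq hcpos, mul_inv_cancel₀]
    exact Real.sqrt_ne_zero'.2 (by positivity)
  simp only [bentStrip, polarMap, vScale, hScale, hY', Prod.mk.injEq, and_true]
  linear_combination (-(1 + a)) * hn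

/-- The reflection `s ↦ 1 - s` of the strip is carried by `Π` to the reflection `X ↦ -X`.
[folklore] -/
theorem polarMap_one_sub (s a : ℝ) :
    polarMap (1 - s, a) = (-(polarMap (s, a)).1, (polarMap (s, a)).2) := by
  simp only [polarMap, mul_sub, mul_one, cos_pi_sub, sin_pi_sub]
  ring_nf

/-- `m` is even. [folklore] -/
theorem mfac_neg (X : ℝ) : mfac (-X) = mfac X := by simp [mfac, lam]

/-- `S_v` commutes with the reflection `X ↦ -X`. [folklore] -/
theorem vScale_neg (X Y : ℝ) : vScale (-X, Y) = (-(vScale (X, Y)).1, (vScale (X, Y)).2) := by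
  simp [vScale, mfac_neg]

/-- `S_h` commutes with the reflection `X ↦ -X`. [folklore] -/
theorem hScale_neg (X Y : ℝ) : hScale (-X, Y) = (-(hScale (X, Y)).1, (hScale (X, Y)).2) := by
  simp [hScale]

/-- The bent strip is symmetric: `Ψ⁻¹ (1 - s, a)` is the mirror image of `Ψ⁻¹ (s, a)`. [folklore] -/
theorem bentStrip_one_sub (s a : ℝ) :
    bentStrip (1 - s, a) = (-(bentStrip (s, a)).1, (bentStrip (s, a)).2) := by
  simp only [bentStrip, polarMap_one_sub]
  rw [show polarMap (s, a) = ((polarMap (s, a)).1, (polarMap (s, a)).2) from rfl, vScale_neg,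
    show vScale _ = ((vScale ((polarMap (s, a)).1, (polarMap (s, a)).2)).1,
      (vScale ((polarMap (s, a)).1, (polarMap (s, a)).2)).2) from rfl, hScale_neg]

/-- **Normal form near the south end**: for `9/10 ≤ s ≤ 1` and `|a| ≤ 3/10`,
`Ψ⁻¹ (s, a) = (1 + a, tan (π (1 - s)))`. [folklore] -/
theorem bentStrip_eq_of_ge {s a : ℝ} (hs : 9 / 10 ≤ s) (hs1 : s ≤ 1) (ha : |a| ≤ 3 / 10) :
    bentStrip (s, a) = (1 + a, tan (π * (1 - s))) := by
  have h := bentStrip_one_sub (1 - s) a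
  rw [sub_sub_cancel, bentStrip_eq_of_le (s := 1 - s) (by linarith) (by linarith) ha] at h
  rw [h]; simp

/-! ### Height bounds -/

/-- A lower bound for the vertical factor: `m(X) ≥ 10/13` whenever `|X| ≤ 13/10`. [folklore] -/
theorem mfac_ge {X : ℝ} (hX : |X| ≤ 13 / 10) : 10 / 13 ≤ mfac X := by
  by_cases h5 : X ^ 2 ≤ 1 / 5
  · rw [mfac_eq_one h5]; norm_num
  · obtain ⟨h0, h1⟩ := lam_mem X
    have hXpos : 0 < |X| := by
      rcases (abs_nonneg X).eq_or_lt with h | h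
      · exfalso; apply h5; nlinarith [sq_abs X]
      · exact h
    have hinv : 10 / 13 ≤ (Real.sqrt (X ^ 2))⁻¹ := by
      rw [Real.sqrt_sq_eq_abs, le_inv_comm₀ (by norm_num) hXpos]; linarith
    unfold mfac; nlinarith

/-- On the strip `[0, 1] × (-1, ∞)` the height `Y''` of the bent strip is nonnegative. [folklore] -/
theorem bentStrip_snd_nonneg {s a : ℝ} (hs : s ∈ Icc (0 : ℝ) 1) (ha : -1 < a) :
    0 ≤ (bentStrip (s, a)).2 := by
  simp only [bentStrip, hScale, vScale, polarMap]
  exact mul_nonneg (mfac_pos _).le (mul_nonneg (by linarith)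
    (sin_nonneg_of_nonneg_of_le_pi (by nlinarith [pi_pos, hs.1]) (by nlinarith [pi_pos, hs.2])))

/-- In the middle `1/10 ≤ s ≤ 9/10` (and `|a| ≤ 3/10`) the bent strip stays at height
`Y'' ≥ 1/10` — far above the band `Y'' < 1/200` where it has to agree with the polar model.
[folklore] -/
theorem bentStrip_snd_ge {s a : ℝ} (hs : s ∈ Icc (1 / 10 : ℝ) (9 / 10)) (ha : |a| ≤ 3 / 10) :
    1 / 10 ≤ (bentStrip (s, a)).2 := by
  obtain ⟨hs0, hs1⟩ := hs
  obtain ⟨ha1, ha2⟩ := abs_le.1 ha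
  have hπ3 : 3 < π := pi_gt_three
  have hπ : π < 3.15 := pi_lt_d2
  -- `sin (π s) ≥ sin (3/10) ≥ 0.29`
  have hsin : 0.29 ≤ sin (π * s) := by
    have hx0 : (0.3 : ℝ) ≤ π * s := by nlinarith
    have hx1 : π * s ≤ π - 0.3 := by nlinarith
    have h03 : (0.29 : ℝ) ≤ sin 0.3 := by
      have := Real.sin_gt_sub_cube (x := 0.3) (by norm_num)
      linarith
    rcases le_total (π * s) (π / 2) with h | h
    · exact h03.trans (sin_le_sin_of_le_of_le_pi_div_two (by linarith) h hx0)
    · have : sin (π - π * s) ≥ sin 0.3 :=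
        sin_le_sin_of_le_of_le_pi_div_two (by linarith) (by linarith) (by linarith)
      rw [sin_pi_sub] at this
      exact h03.trans this
  have hcos : |cos (π * s)| ≤ 1 := abs_cos_le_one _
  have hX : |-(1 + a) * cos (π * s)| ≤ 13 / 10 := by
    rw [abs_mul, abs_neg, abs_of_pos (by linarith : (0 : ℝ) < 1 + a)]; nlinarith
  have hm := mfac_ge hX
  have hY : 0.203 ≤ (1 + a) * sin (π * s) := by nlinarith
  simp only [bentStrip, hScale, vScale, polarMap]
  nlinarith

/-! ### Explicit inverses -/

/-- The complex number `Y + iX` attached to a point `(X, Y)` of the plane (so that the polar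
angle of `Π(s, a)` is `π s - π/2 ∈ (-π, π)` for `s ∈ (-1/2, 3/2)`). [folklore] -/
def swapC (p : ℝ × ℝ) : ℂ := Complex.equivRealProdCLM.symm (p.2, p.1)

/-- Real part of `swapC`. [folklore] -/
@[simp] theorem swapC_re (p : ℝ × ℝ) : (swapC p).re = p.2 := by simp [swapC]

/-- Imaginary part of `swapC`. [folklore] -/
@[simp] theorem swapC_im (p : ℝ × ℝ) : (swapC p).im = p.1 := by simp [swapC]

/-- `swapC` is smooth (linear). [folklore] -/
theorem contDiff_swapC : ContDiff ℝ ∞ swapC :=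
  Complex.equivRealProdCLM.symm.contDiff.comp (contDiff_snd.prodMk contDiff_fst)

/-- **Explicit inverse of the polar map**: `Π⁻¹(X, Y) = ((arg (Y + iX) + π/2)/π, |Y + iX| - 1)`.
[folklore] -/
def polarMapInv (p : ℝ × ℝ) : ℝ × ℝ := ((Complex.arg (swapC p) + π / 2) / π, ‖swapC p‖ - 1)

/-- `Π ∘ Π⁻¹ = id` (everywhere). [folklore] -/
theorem polarMap_polarMapInv (p : ℝ × ℝ) : polarMap (polarMapInv p) = p := by
  rcases eq_or_ne (swapC p) 0 with h0 | h0
  · have h1 : p.1 = 0 := by simpa using congrArg Complex.im h0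
    have h2 : p.2 = 0 := by simpa using congrArg Complex.re h0
    ext <;> simp [polarMap, polarMapInv, h0, h1, h2]
  have hn : ‖swapC p‖ ≠ 0 := norm_ne_zero_iff.2 h0
  have e1 : π * ((Complex.arg (swapC p) + π / 2) / π) = Complex.arg (swapC p) + π / 2 :=
    mul_div_cancel₀ _ pi_pos.ne'
  ext
  · simp only [polarMap, polarMapInv, e1, cos_add_pi_div_two, Complex.sin_arg]
    field_simp
    simp
  · simp only [polarMap, polarMapInv, e1, sin_add_pi_div_two, Complex.cos_arg h0]
    field_simp
    simp

/-- `Π⁻¹ ∘ Π = id` on `(-1/2, 3/2] × (-1, ∞)`. [folklore] -/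
theorem polarMapInv_polarMap {s a : ℝ} (hs : s ∈ Ioc (-1 / 2 : ℝ) (3 / 2)) (ha : -1 < a) :
    polarMapInv (polarMap (s, a)) = (s, a) := by
  have hρ : 0 < 1 + a := by linarith
  have hz : swapC (polarMap (s, a)) = ↑(1 + a) * (Complex.cos ↑(π * s - π / 2) +
      Complex.sin ↑(π * s - π / 2) * Complex.I) := by
    rw [← Complex.ofReal_cos, ← Complex.ofReal_sin, cos_sub_pi_div_two, sin_sub_pi_div_two]
    apply Complex.ext <;>
      simp only [swapC_re, swapC_im, polarMap, Complex.re_ofReal_mul, Complex.im_ofReal_mul,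
        Complex.add_re, Complex.add_im, Complex.ofReal_re, Complex.ofReal_im, Complex.mul_I_re,
        Complex.mul_I_im] <;> ring
  have harg : Complex.arg (swapC (polarMap (s, a))) = π * s - π / 2 := by
    rw [hz]
    exact Complex.arg_mul_cos_add_sin_mul_I hρ ⟨by nlinarith [hs.1, pi_pos], by nlinarith [hs.2, pi_pos]⟩
  have hnorm : ‖swapC (polarMap (s, a))‖ = 1 + a := by
    rw [hz, norm_mul, Complex.norm_cos_add_sin_mul_I, mul_one, Complex.norm_real,
      Real.norm_of_nonneg hρ.le]
  ext
  · simp only [polarMapInv, harg]; field_simp; ring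
  · simp only [polarMapInv, hnorm]; ring

/-- `Π⁻¹` is smooth off the closed half-line `{X = 0, Y ≤ 0}`. [folklore] -/
theorem contDiffAt_polarMapInv {p : ℝ × ℝ} (h : 0 < p.2 ∨ p.1 ≠ 0) :
    ContDiffAt ℝ ∞ polarMapInv p := by
  have hslit : swapC p ∈ Complex.slitPlane := by
    rcases h with h | h
    · exact Or.inl (by simpa using h)
    · exact Or.inr (by simpa using h)
  have h0 : swapC p ≠ 0 := Complex.slitPlane_ne_zero hslit
  refine (((contDiffAt_arg hslit).comp p contDiff_swapC.contDiffAt).add contDiffAt_const).div_const _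
    |>.prodMk ?_
  exact ((contDiffAt_norm ℝ h0).comp p contDiff_swapC.contDiffAt).sub contDiffAt_const

/-- **Explicit inverse of the bent strip** `Ψ = Π⁻¹ ∘ S_v⁻¹ ∘ S_h⁻¹`. [folklore] -/
def bentStripInv (p : ℝ × ℝ) : ℝ × ℝ := polarMapInv (vScaleInv (hScaleInv p))

/-- `Ψ⁻¹ ∘ Ψ = id` everywhere: the bent strip map is onto the plane and `Ψ` is a global right
inverse. [folklore] -/
@[simp] theorem bentStrip_bentStripInv (p : ℝ × ℝ) : bentStrip (bentStripInv p) = p := by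
  simp [bentStrip, bentStripInv, polarMap_polarMapInv]

/-- `Ψ ∘ Ψ⁻¹ = id` on the strip `(-1/2, 3/2] × (-1, ∞)`. [folklore] -/
theorem bentStripInv_bentStrip {s a : ℝ} (hs : s ∈ Ioc (-1 / 2 : ℝ) (3 / 2)) (ha : -1 < a) :
    bentStripInv (bentStrip (s, a)) = (s, a) := by
  simp [bentStrip, bentStripInv, polarMapInv_polarMap hs ha]

/-- Hence the bent strip is injective on the larger strip `(-1/2, 3/2] × (-1, ∞)`. [folklore] -/
theorem bentStrip_injOn' : InjOn bentStrip (Ioc (-1 / 2 : ℝ) (3 / 2) ×ˢ Ioi (-1 : ℝ)) := by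
  rintro ⟨s, a⟩ ⟨hs, ha⟩ ⟨s', a'⟩ ⟨hs', ha'⟩ h
  rw [← bentStripInv_bentStrip hs ha, ← bentStripInv_bentStrip hs' ha', h]

/-- `Ψ` is smooth off the half-line `{X = 0, Y ≤ 0}` (which is disjoint from the image of the
strip `[0, 1] × (-1, ∞)`). [folklore] -/
theorem contDiffAt_bentStripInv {p : ℝ × ℝ} (h : 0 < p.2 ∨ p.1 ≠ 0) :
    ContDiffAt ℝ ∞ bentStripInv p := by
  refine (contDiffAt_polarMapInv ?_).comp p
    (contDiff_vScaleInv.contDiffAt.comp p contDiff_hScaleInv.contDiffAt)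
  simp only [vScaleInv, hScaleInv]
  rcases h with h | h
  · exact Or.inl (mul_pos (inv_pos.2 (mfac_pos _)) h)
  · exact Or.inr (mul_ne_zero (inv_ne_zero (nfac_pos _).ne') h)

/-- The image of the strip `[0, 1] × (-1, ∞)` avoids the half-line `{X = 0, Y ≤ 0}`. [folklore] -/
theorem bentStrip_mem_good {s a : ℝ} (hs : s ∈ Icc (0 : ℝ) 1) (ha : -1 < a) :
    0 < (bentStrip (s, a)).2 ∨ (bentStrip (s, a)).1 ≠ 0 := by
  obtain ⟨hs0, hs1⟩ := hs
  have hρ : 0 < 1 + a := by linarith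
  simp only [bentStrip, hScale, vScale, polarMap]
  rcases eq_or_lt_of_le hs0 with rfl | hpos
  · exact Or.inr (mul_ne_zero (nfac_pos _).ne'
      (by rw [mul_zero, cos_zero, mul_one]; exact neg_ne_zero.2 hρ.ne'))
  rcases eq_or_lt_of_le hs1 with rfl | hlt
  · exact Or.inr (mul_ne_zero (nfac_pos _).ne'
      (by rw [mul_one, cos_pi, mul_neg_one, neg_neg]; exact hρ.ne'))
  · left
    exact mul_pos (mfac_pos _) (mul_pos hρ (sin_pos_of_pos_of_lt_pi (by positivity)
      (by nlinarith [pi_pos])))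

/-- `Ψ` is smooth at every point of the image of the strip `[0, 1] × (-1, ∞)`. [folklore] -/
theorem contDiffAt_bentStripInv_bentStrip {s a : ℝ} (hs : s ∈ Icc (0 : ℝ) 1) (ha : -1 < a) :
    ContDiffAt ℝ ∞ bentStripInv (bentStrip (s, a)) :=
  contDiffAt_bentStripInv (bentStrip_mem_good hs ha)

end HandlePlanar
end Literature.Topology.FourManifolds
end
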